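import Summits.BirchSwinnertonDyer.BirchSwinnertonDyer.Theorems.TwoAdicConverseOffHabitatStrata
import HarnessLib

/-!
# Route TwoAdicConverse — off-habitat strata, part 2: the rung leaf (`r ≤ 1`) by strata, and the
# `¬ HasCM` binder is idle on the big-image habitat (kernel glue; proofs only)

Cell `bsd-2adic`, seat `bsd-2adic-conv-1` GEN 18 (`--supports` item stmt-BirchSwinnertonDyer-19218; nothing
here closes it).  Companion of `TwoAdicConverseOffHabitatStrata` (same session): (§1–§2) the habitat theorems
of p607060 (`TwoAdicKolyvaginRankZero.*_bigImage`) with the binder `¬ W.HasCM` DROPPED — by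
`WeierstrassCurve.not_hasCM_of_forall_hasSurjectiveModNGaloisRep_two_pow` (p613962: a CM curve over `ℚ`
is never onto modulo `4`, Lozano-Robledo 2022 Thm 1.1 / Dokchitser–Dokchitser (2)) a curve with
surjective `2`-adic image has no CM, so the `¬CM` binder carried by the cruxes 24622 V1′ / 24623 V2♭ and
the residuals 24303 / 24404 is implied by their habitat binder; at a good ordinary `2` the habitat binder
itself is just «`ρ̄_{W,4}` onto» (`analyticRank_eq_zero_of_selmerCorank_eq_zero_goodOrd_of_surjective_four`);
(§3) the `r ≤ 1` off-habitat binder of the rung leaf `NonCMTwoConverse` (KRR2's residual 24303 = item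
24404 ∪ its `r = 0` twin) split into the four LEVEL strata with proved glue, and the leaf BY NAME from
24622 + 24623 + 24405 + 23951 + BFH + GZK + the four pieces; (§4) a CM curve is off the habitat and
lies in stratum (β) or on the Dokchitser–Dokchitser curve.

HONEST FRAMING.  Pure logic over PROVED image theorems; V1′, V2♭ and the stratum pieces are OPEN
hypotheses, the PRINT inputs are the tree's named facts taken as hypotheses; no item is filed (D-0014),
nothing is booked (D-0054); BSD is not proved by any of this.  PARTITION: none — RANK axis (S3);
companion cell X5@2 good-ord/mult, habitat/complement boundary.

References: T. Dokchitser, V. Dokchitser, Math. Z. 272 (2012) 961–964 [DokchitserDokchitserMathZ2012];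
Á. Lozano-Robledo, Algebra Number Theory 16 (2022) Thm 1.1 [LozanoRobledo2022]; W. Zhang, Camb. J. Math.
2 (2014) Thm 1.1 [WZhang2014]; J. Rouse, D. Zureick-Brown, Res. Number Theory 1 (2015) [RouseZureickbrown2015].
-/

set_option autoImplicit false
-- the Theorems namespace of this sub repeats the summit name by design (D-0017 nested layout)
set_option linter.dupNamespace false

namespace Summit.BirchSwinnertonDyer.BirchSwinnertonDyer.Theorems.TwoAdicOffHabitat

open Literature Literature.NumberTheory.EllipticCurves Literature.NumberTheory.EllipticCurves.ModularForms
  Literature.NumberTheory.EllipticCurves.Rank1Residual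
  Summit.BirchSwinnertonDyer.BirchSwinnertonDyer.Theses.TwoAdicConverse
  Summit.BirchSwinnertonDyer.BirchSwinnertonDyer.Theorems.TwoAdicKolyvaginRankZero

/-! ## §1 The `¬ HasCM` binder is idle on the habitat -/

/-- **The rank-`0` `2`-converse on the big-image habitat WITHOUT the `¬CM` binder**: p607060's
`analyticRank_eq_zero_of_selmerCorank_eq_zero_bigImage` with `hCM` discharged by
`WeierstrassCurve.not_hasCM_of_forall_hasSurjectiveModNGaloisRep_two_pow` (a CM curve is never onto
modulo `4`). [cite: LozanoRobledo2022, Thm. 1.1 (N = 4)] [cite: WZhang2014, Thm. 1.1 (shape at p ≥ 5)] -/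
theorem analyticRank_eq_zero_of_selmerCorank_eq_zero_bigImage_noCM
    (hV1 : KolyvaginNonvanishingAtTwoFrame) (hV2 : KolyvaginCorankLowerBoundAtTwo)
    (hT : NoTwoTorsionOverK)
    (hmod : exists_isNewformOf)
    (hBFH : bumpFriedbergHoffstein_exists_heegnerField_split_twist_simpleZero)
    (hpar : ∀ (V : WeierstrassCurve ℚ) [V.IsElliptic], p_parity V 2)
    (hGZK : rank_eq_analyticRank_of_analyticRank_le_one)
    (hE : WeierstrassCurve.hasEntireLFunction_rat)
    (hGZ : ∀ (V : WeierstrassCurve ℚ) (N : ℕ) [NeZero N] (K : Type) [Field K] [NumberField K],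
      analyticRankEK_eq_one_iff_heegner_nonTorsion V N K)
    (hrec : ∀ (N : ℕ) [NeZero N] (V : WeierstrassCurve ℚ) (K : Type) [Field K] [NumberField K],
      heegnerPointOfConductor_one_galoisConj N V K)
    (W : WeierstrassCurve ℚ) [W.IsElliptic] [W.IsGloballyMinimal]
    (hred : GoodOrd W 2 ∨ Mult W 2) (hsur : ∀ m : ℕ, W.HasSurjectiveModNGaloisRep (2 ^ m : ℕ))
    (hc : W.selmerCorank 2 = 0) : W.analyticRank = 0 :=
  analyticRank_eq_zero_of_selmerCorank_eq_zero_bigImage hV1 hV2 hT hmod hBFH hpar hGZK hE hGZ hrec W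
    (W.not_hasCM_of_forall_hasSurjectiveModNGaloisRep_two_pow hsur) hred hsur hc

/-- **The rung leaf (`r ≤ 1`) on the big-image habitat WITHOUT the `¬CM` binder**: p607060's
`analyticRank_eq_of_selmerCorank_eq_bigImage` with `hCM` discharged.
[cite: LozanoRobledo2022, Thm. 1.1 (N = 4)] [cite: WZhang2014, Thm. 1.1 (shape at p ≥ 5)] -/
theorem analyticRank_eq_of_selmerCorank_eq_bigImage_noCM
    (hV1 : KolyvaginNonvanishingAtTwoFrame) (hV2 : KolyvaginCorankLowerBoundAtTwo)
    (hT : NoTwoTorsionOverK)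
    (hmod : exists_isNewformOf)
    (hBFH : bumpFriedbergHoffstein_exists_heegnerField_split_twist_simpleZero)
    (hHL : HoffsteinLuo1997_exists_twist_L_one_ne_zero)
    (hpar : ∀ (V : WeierstrassCurve ℚ) [V.IsElliptic], p_parity V 2)
    (hKato : ∀ (V : WeierstrassCurve ℚ) [V.IsElliptic], kato_finite_of_L_one_ne_zero V 2)
    (hGZK : rank_eq_analyticRank_of_analyticRank_le_one)
    (hE : WeierstrassCurve.hasEntireLFunction_rat)
    (hGZ : ∀ (V : WeierstrassCurve ℚ) (N : ℕ) [NeZero N] (K : Type) [Field K] [NumberField K],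
      analyticRankEK_eq_one_iff_heegner_nonTorsion V N K)
    (hrec : ∀ (N : ℕ) [NeZero N] (V : WeierstrassCurve ℚ) (K : Type) [Field K] [NumberField K],
      heegnerPointOfConductor_one_galoisConj N V K)
    (W : WeierstrassCurve ℚ) [W.IsElliptic] [W.IsGloballyMinimal]
    (hred : GoodOrd W 2 ∨ Mult W 2) (hsur : ∀ m : ℕ, W.HasSurjectiveModNGaloisRep (2 ^ m : ℕ))
    (r : ℕ) (hr : r ≤ 1) (hc : W.selmerCorank 2 = r) : W.analyticRank = r :=
  analyticRank_eq_of_selmerCorank_eq_bigImage hV1 hV2 hT hmod hBFH hHL hpar hKato hGZK hE hGZ hrec W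
    (W.not_hasCM_of_forall_hasSurjectiveModNGaloisRep_two_pow hsur) hred hsur r hr hc

/-- **The leaf restricted to the habitat, packaged against `PrintedInputsRankOneAtTwo` (item 23951),
WITHOUT the `¬CM` binder.** [cite: LozanoRobledo2022, Thm. 1.1 (N = 4)] [cite: WZhang2014, Thm. 1.1 (shape)] -/
theorem nonCMTwoConverse_bigImage_of_kolyvaginAtTwo_noCM
    (hV1 : KolyvaginNonvanishingAtTwoFrame) (hV2 : KolyvaginCorankLowerBoundAtTwo)
    (hT : NoTwoTorsionOverK) (hIn : PrintedInputsRankOneAtTwo)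
    (hBFH : bumpFriedbergHoffstein_exists_heegnerField_split_twist_simpleZero)
    (hGZK : rank_eq_analyticRank_of_analyticRank_le_one)
    (W : WeierstrassCurve ℚ) [W.IsElliptic] [W.IsGloballyMinimal]
    (hred : GoodOrd W 2 ∨ Mult W 2) (hsur : ∀ m : ℕ, W.HasSurjectiveModNGaloisRep (2 ^ m : ℕ))
    (r : ℕ) (hr : r ≤ 1) (hc : W.selmerCorank 2 = r) : W.analyticRank = r :=
  nonCMTwoConverse_bigImage_of_kolyvaginAtTwo hV1 hV2 hT hIn hBFH hGZK W
    (W.not_hasCM_of_forall_hasSurjectiveModNGaloisRep_two_pow hsur) hred hsur r hr hc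

/-! ## §2 At a good ordinary `2` the habitat binder is `ρ̄₄` onto -/

/-- **At a good ordinary `2` the habitat binder is `ρ̄_{W,4}` onto** (the `2`-adic image is decided
modulo `4` there): the big-image theorems apply to every non-CM… indeed to every `W` good ordinary at
`2` with `ρ̄_{W,4}` onto (CM being excluded automatically). Rank-`0` form.
[cite: DokchitserDokchitserMathZ2012, Theorem (3)] [cite: LozanoRobledo2022, Thm. 1.1 (N = 4)] -/
theorem analyticRank_eq_zero_of_selmerCorank_eq_zero_goodOrd_of_surjective_four
    (hV1 : KolyvaginNonvanishingAtTwoFrame) (hV2 : KolyvaginCorankLowerBoundAtTwo)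
    (hT : NoTwoTorsionOverK)
    (hmod : exists_isNewformOf)
    (hBFH : bumpFriedbergHoffstein_exists_heegnerField_split_twist_simpleZero)
    (hpar : ∀ (V : WeierstrassCurve ℚ) [V.IsElliptic], p_parity V 2)
    (hGZK : rank_eq_analyticRank_of_analyticRank_le_one)
    (hE : WeierstrassCurve.hasEntireLFunction_rat)
    (hGZ : ∀ (V : WeierstrassCurve ℚ) (N : ℕ) [NeZero N] (K : Type) [Field K] [NumberField K],
      analyticRankEK_eq_one_iff_heegner_nonTorsion V N K)
    (hrec : ∀ (N : ℕ) [NeZero N] (V : WeierstrassCurve ℚ) (K : Type) [Field K] [NumberField K],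
      heegnerPointOfConductor_one_galoisConj N V K)
    (W : WeierstrassCurve ℚ) [W.IsElliptic] [W.IsGloballyMinimal] (hgo : GoodOrd W 2)
    (h4 : W.HasSurjectiveModNGaloisRep 4) (hc : W.selmerCorank 2 = 0) : W.analyticRank = 0 :=
  analyticRank_eq_zero_of_selmerCorank_eq_zero_bigImage_noCM hV1 hV2 hT hmod hBFH hpar hGZK hE hGZ hrec W
    (Or.inl hgo) ((forall_hasSurjectiveModNGaloisRep_two_pow_iff_four_of_good_two W hgo.1).mpr h4) hc


/-! ## §3 The rung leaf (`r ≤ 1`, good-ordinary or multiplicative) by strata -/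

/-- **The `r ≤ 1` off-habitat binder of the leaf from its four LEVEL-stratum pieces** (the union of
item 24404 `RankOneTwoConverseOffBigImage` and its `r = 0` twin — KRR2's residual 24303 — split by
level). [cite: DokchitserDokchitserMathZ2012, Theorem (1)–(3)] [cite: RouseZureickbrown2015, §1] -/
theorem leaf_offBigImage_of_strata
    (h2t : ∀ (W : WeierstrassCurve ℚ) [W.IsElliptic] [W.IsGloballyMinimal], ¬ W.HasCM →
      (GoodOrd W 2 ∨ Mult W 2) → (∃ P : W.toAffine.Point, P ≠ 0 ∧ 2 • P = 0) →
      ∀ r : ℕ, r ≤ 1 → W.selmerCorank 2 = r → W.analyticRank = r)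
    (h2c : ∀ (W : WeierstrassCurve ℚ) [W.IsElliptic] [W.IsGloballyMinimal], ¬ W.HasCM →
      (GoodOrd W 2 ∨ Mult W 2) → (∀ P : W.toAffine.Point, 2 • P = 0 → P = 0) →
      ¬ W.HasSurjectiveModNGaloisRep 2 → ∀ r : ℕ, r ≤ 1 → W.selmerCorank 2 = r → W.analyticRank = r)
    (h4 : ∀ (W : WeierstrassCurve ℚ) [W.IsElliptic] [W.IsGloballyMinimal], ¬ W.HasCM →
      (GoodOrd W 2 ∨ Mult W 2) → W.HasSurjectiveModNGaloisRep 2 → ¬ W.HasSurjectiveModNGaloisRep 4 →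
      ∀ r : ℕ, r ≤ 1 → W.selmerCorank 2 = r → W.analyticRank = r)
    (h8 : ∀ (W : WeierstrassCurve ℚ) [W.IsElliptic] [W.IsGloballyMinimal], ¬ W.HasCM →
      (GoodOrd W 2 ∨ Mult W 2) → W.HasSurjectiveModNGaloisRep 4 → ¬ W.HasSurjectiveModNGaloisRep 8 →
      ∀ r : ℕ, r ≤ 1 → W.selmerCorank 2 = r → W.analyticRank = r) :
    ∀ (W : WeierstrassCurve ℚ) [W.IsElliptic] [W.IsGloballyMinimal], ¬ W.HasCM →
      (GoodOrd W 2 ∨ Mult W 2) → ¬ (∀ m : ℕ, W.HasSurjectiveModNGaloisRep (2 ^ m : ℕ)) →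
      ∀ r : ℕ, r ≤ 1 → W.selmerCorank 2 = r → W.analyticRank = r := by
  intro W _ _ hCM hred hoff r hr hc
  exact offHabitat_elim_strata hoff (fun h ↦ h2t W hCM hred h r hr hc)
    (fun h h' ↦ h2c W hCM hred h h' r hr hc) (fun h h' ↦ h4 W hCM hred h h' r hr hc)
    (fun h h' ↦ h8 W hCM hred h h' r hr hc)

/-- **The rung leaf `NonCMTwoConverse` from Kolyvagin at `2` on the habitat (24622 + 24623 + 24405 +
23951 + BFH + GZK, p607060) and the four LEVEL-stratum pieces of the off-habitat complement.**
Nothing is asserted as a route edit; BSD is not proved by this. [cite: WZhang2014, Thm. 1.1 (shape)]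
[cite: DokchitserDokchitserMathZ2012, Theorem (1)–(3)] -/
theorem nonCMTwoConverse_of_kolyvaginAtTwo_of_strata
    (hV1 : KolyvaginNonvanishingAtTwoFrame) (hV2 : KolyvaginCorankLowerBoundAtTwo)
    (hT : NoTwoTorsionOverK) (hIn : PrintedInputsRankOneAtTwo)
    (hBFH : bumpFriedbergHoffstein_exists_heegnerField_split_twist_simpleZero)
    (hGZK : rank_eq_analyticRank_of_analyticRank_le_one)
    (h2t : ∀ (W : WeierstrassCurve ℚ) [W.IsElliptic] [W.IsGloballyMinimal], ¬ W.HasCM →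
      (GoodOrd W 2 ∨ Mult W 2) → (∃ P : W.toAffine.Point, P ≠ 0 ∧ 2 • P = 0) →
      ∀ r : ℕ, r ≤ 1 → W.selmerCorank 2 = r → W.analyticRank = r)
    (h2c : ∀ (W : WeierstrassCurve ℚ) [W.IsElliptic] [W.IsGloballyMinimal], ¬ W.HasCM →
      (GoodOrd W 2 ∨ Mult W 2) → (∀ P : W.toAffine.Point, 2 • P = 0 → P = 0) →
      ¬ W.HasSurjectiveModNGaloisRep 2 → ∀ r : ℕ, r ≤ 1 → W.selmerCorank 2 = r → W.analyticRank = r)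
    (h4 : ∀ (W : WeierstrassCurve ℚ) [W.IsElliptic] [W.IsGloballyMinimal], ¬ W.HasCM →
      (GoodOrd W 2 ∨ Mult W 2) → W.HasSurjectiveModNGaloisRep 2 → ¬ W.HasSurjectiveModNGaloisRep 4 →
      ∀ r : ℕ, r ≤ 1 → W.selmerCorank 2 = r → W.analyticRank = r)
    (h8 : ∀ (W : WeierstrassCurve ℚ) [W.IsElliptic] [W.IsGloballyMinimal], ¬ W.HasCM →
      (GoodOrd W 2 ∨ Mult W 2) → W.HasSurjectiveModNGaloisRep 4 → ¬ W.HasSurjectiveModNGaloisRep 8 →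
      ∀ r : ℕ, r ≤ 1 → W.selmerCorank 2 = r → W.analyticRank = r) :
    Summit.BirchSwinnertonDyer.BirchSwinnertonDyer.Rank1Residual.NonCMTwoConverse :=
  nonCMTwoConverse_of_kolyvaginAtTwo_of_offBigImage hV1 hV2 hT hIn hBFH hGZK
    (leaf_offBigImage_of_strata h2t h2c h4 h8)

/-! ## §4 CM curves are off the habitat (so `hOff`'s `¬CM` binder is where CM is actually excluded) -/

/-- **A CM curve good-ordinary at `2` is OFF the habitat and lies in stratum (S2t) or (S4)**: its `j`
is `-4t³(t + 8)` (then `ρ̄₄` is not onto) or it has a rational point of order `2` (p613962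
`exists_two_torsion_or_j_eq_of_hasCM`).  So in the glued shape of §4 the hypothesis `¬ W.HasCM` is
idle on the habitat part (§2) and bites only inside the strata pieces.
[cite: LozanoRobledo2022, Thm. 1.1 (N = 4)] [cite: SilvermanAEC2009, App. C §11] -/
theorem offBigImage_of_hasCM (W : WeierstrassCurve ℚ) [W.IsElliptic] (hCM : W.HasCM) :
    ¬ (∀ m : ℕ, W.HasSurjectiveModNGaloisRep (2 ^ m : ℕ)) ∧
      ((∃ P : W.toAffine.Point, P ≠ 0 ∧ 2 • P = 0) ∨ ∃ t : ℚ, W.j = -4 * t ^ 3 * (t + 8)) :=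
  ⟨W.not_forall_hasSurjectiveModNGaloisRep_two_pow_of_hasCM hCM, exists_two_torsion_or_j_eq_of_hasCM W hCM⟩

end Summit.BirchSwinnertonDyer.BirchSwinnertonDyer.Theorems.TwoAdicOffHabitat
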